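import Literature.AlgebraicGeometry.Frobenioids.FiberProductsMorphisms
import Literature.AlgebraicGeometry.Frobenioids.EndomorphismsNonExpanding
import HarnessLib

/-!
# Frobenioids I, Proposition 1.6 (vi), clause «Aut^sub-ample»: what the lifting argument proves

Mochizuki, *The geometry of Frobenioids I: the general theory*, Kyushu J. Math. **62** (2008)
293–400, §1, Proposition 1.6 (vi) and its proof, printed p. 317 (kurims text p. 27)
[cite: MochizukiFrdI2008, Prop. 1.6(vi) p.27]:

> "(vi) A object of `C′` is Aut-ample (respectively, Aut^sub-ample; End-ample) if it projects to
> such an object of `C`." … "Now assertion (vi) follows immediately from the definitions".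

Here `C → F_Φ` is a Frobenioid over `D`, `D′ → D` a functor and `C′ := C ×_D D′` with its functor
`C′ → F_{Φ′}` (`FiberProducts.lean`: `PreFrobenioid.FiberProduct`, `fiberProductFunctor`); the
clauses «Aut-ample» and «End-ample» are `isAutAmple_fiberProduct_of_fst`,
`isEndAmple_fiberProduct_of_fst` (`FiberProductsMorphisms.lean`).  The clause «Aut^sub-ample»,
direction `C ⇒ C′`, is FALSE AS PRINTED (abc-iut finding F-w5d202-1: kernel witness
`AutSubAmpleCex.not_prop16viAutSubAmpleIf` against the closed statement
`PreFrobenioid.Prop16viAutSubAmpleIf`; a model Frobenioid over a three-object base whose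
`Aut^sub`-ample object `A` admits only NON-isometric lifts of the sub-automorphisms of `A_D`).

PROOF-ONLY companion (no new definitions; statements of other files untouched).  What the evident
lifting argument DOES give, recorded as theorems (OURS — the extra hypotheses are named repairs,
not attributed to the paper):

* `FiberProduct.isSubAutomorphism_of_isIsometry_isLinear` — the mechanism: for
  `X = (A, A′, α) ∈ Ob(C′)`, an ISOMETRIC LINEAR endomorphism `a` of `A` lying over
  `α⁻¹ ∘ G(f′) ∘ α` for a sub-automorphism `f′` of `A′` in `D′` yields a sub-automorphism
  `(a, f′)` of `X`: realise the `D′`-witness `φ′ : B′ → A′`, `β′ ∈ Aut(B′)` of `f′` by a pull-back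
  morphism `φ : B → A` over `G(φ′)` [Def. 1.3 (i)(c)], lift `a` along `φ` to `β : B → B` over
  `G(β′)` [Prop. 1.11 (iii)]; `β` is a linear isometric base-isomorphism [Remark 1.1.1], co-angular
  [Def. 1.3 (iii)(b)], hence an isomorphism [Prop. 1.4 (iii)] — exactly the argument of the printed
  sufficiency half of Prop. 1.12 (ii) (`isSubAutomorphism_of_isIsometry_isLinear`,
  `Endomorphisms.lean`), run with prescribed projections;
* `isAutSubAmple_fiberProduct_of_isometricLifts` — hence `X` is `Aut^sub`-ample in `C′` as soon
  as every sub-automorphism of `A_D` lifts to an isometric linear endomorphism of `A`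
  ("`A` is isometrically `Aut^sub`-ample"), and this property is inherited by `X`
  (`isometricLifts_fiberProduct_of_fst`);
* corollaries: the printed clause holds for `A` `Aut^sub`-ample whenever the sub-automorphisms of
  `A` are isometric — i.e. under the printed necessity half of Prop. 1.12 (ii) at `A`
  (`SubAutomorphismIsIsometryStatement F A`, itself false in general and true under the cell's
  repairs): under `AutFixesDiv F` (abc-iut-L1-t1), under the elementwise non-expanding hypothesis
  `IsAutNonExpandingOn Φ` (RULING P12-NE, `EndomorphismsNonExpanding.lean`), in particular when
  base automorphisms act on divisors with finite order; and for `Aut`-ample `A` over an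
  `Aut`-saturated `A_D`.

Nothing here bears on [IUTchIII] Cor. 3.12; no statement of the paper is strengthened, and the
refuted clause is not asserted.
-/

namespace Literature.AlgebraicGeometry.Frobenioids

open CategoryTheory Opposite

universe w v v' v'' u u' u''

namespace PreFrobenioid

variable {D : Type u} [Category.{v} D] {D' : Type u'} [Category.{v'} D']
  {Φ : Dᵒᵖ ⥤ CommMonCat.{w}} {C : Type u''} [Category.{v''} C]
  {F : C ⥤ ElemFrobenioid Φ} {G : D' ⥤ D}

/-! ### The lifting mechanism with prescribed projections -/

/-- The image under `D′ → D` of a sub-automorphism `f′` of `A′`, conjugated by the identification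
`α : A_D ≅ G(A′)` of an object `X = (A, A′, α)` of `C′`, is a sub-automorphism of `A_D`
(functors and conjugation preserve the defining square `φ ∘ β = α ∘ φ` of §0).
[cite: MochizukiFrdI2008, Prop. 1.6(vi) p.27] -/
theorem FiberProduct.isSubAutomorphism_conj_map (X : FiberProduct F G) {f' : X.snd ⟶ X.snd}
    (hf' : IsSubAutomorphism f') : IsSubAutomorphism (X.e.hom ≫ G.map f' ≫ X.e.inv) := by
  obtain ⟨B', φ', β', hsq'⟩ := hf'
  refine ⟨G.obj B', G.map φ' ≫ X.e.inv, G.mapIso β', ?_⟩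
  show G.map β'.hom ≫ G.map φ' ≫ X.e.inv = (G.map φ' ≫ X.e.inv) ≫ X.e.hom ≫ G.map f' ≫ X.e.inv
  rw [← G.map_comp_assoc, hsq', G.map_comp_assoc, Category.assoc, X.e.inv_hom_id_assoc]

/-- **The mechanism behind Prop. 1.6 (vi) «Aut^sub-ample»** (OURS, as a theorem about what the
lifting argument proves): for `X = (A, A′, α) ∈ Ob(C′)`, a sub-automorphism `f′` of `A′` in `D′`
and an ISOMETRIC LINEAR endomorphism `a` of `A` compatible with `f′` (`α ∘ a_D = G(f′) ∘ α`), the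
endomorphism `(a, f′)` of `X` is a sub-automorphism of `X` in `C′`.  Proof: take the `D′`-witness
`φ′ : B′ → A′`, `β′ ∈ Aut_{D′}(B′)`, `φ′ ∘ β′ = f′ ∘ φ′`; a pull-back morphism `φ : B → A` of `C`
over `α⁻¹ ∘ G(φ′)` [Def. 1.3 (i)(c)]; the unique lift `β : B → B` of `a` along `φ` over (the
conjugate of) `G(β′)` [Prop. 1.11 (iii)]; by Remark 1.1.1 `β` is linear and isometric (this is where
`Div(a) = 0` is used), a base-isomorphism, co-angular [Def. 1.3 (iii)(b)], hence an isomorphism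
[Prop. 1.4 (iii)]; then `(B, B′)`, `(φ, φ′)`, `(β, β′)` is a witness in `C′`.
[cite: MochizukiFrdI2008, Prop. 1.6(vi) p.27] -/
theorem FiberProduct.isSubAutomorphism_of_isIsometry_isLinear (hF : IsFrobenioid F)
    (X : FiberProduct F G) {a : X.fst ⟶ X.fst} (hiso : IsIsometry F a) (hlin : IsLinear F a)
    {f' : X.snd ⟶ X.snd} (hf' : IsSubAutomorphism f')
    (hw : Base F a ≫ X.e.hom = X.e.hom ≫ G.map f') :
    IsSubAutomorphism (show X ⟶ X from ⟨a, f', hw⟩) := by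
  obtain ⟨B', φ', β', hsq'⟩ := hf'
  -- a pull-back morphism `φ : B → A` over `G(φ′)` (composed with `α⁻¹`)
  obtain ⟨B, φ, i, hφ, hφb⟩ := exists_isPullbackMorphism_over hF X.fst (G.map φ' ≫ X.e.inv)
  have ha : Base F a = X.e.hom ≫ G.map f' ≫ X.e.inv := by
    rw [← Category.assoc, ← hw, Category.assoc, X.e.hom_inv_id, Category.comp_id]
  -- the lift `β` of `a` along `φ` over the conjugate of `G(β′)`
  obtain ⟨β, ⟨hβb, hβ⟩, -⟩ := existsUnique_endo_lift hφ a (i.hom ≫ G.map β'.hom ≫ i.inv) (by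
    rw [hφb, ha, Category.assoc, Category.assoc, X.e.inv_hom_id_assoc, ← G.map_comp_assoc,
      ← hsq', G.map_comp_assoc, Category.assoc, Category.assoc, i.inv_hom_id_assoc])
  obtain ⟨⟨-, hφiso⟩, hφlin⟩ := hF.iv_b φ hφ
  -- `β` is a linear isometric base-isomorphism, hence (co-angular by Def. 1.3 (iii)(b)) an iso
  have hβlin : IsLinear F β := by
    have hd := congrArg (degFr F) hβ
    rw [degFr_comp, degFr_comp, show degFr F a = 1 from hlin, show degFr F φ = 1 from hφlin,
      mul_one, mul_one] at hd
    exact hd.symm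
  have hβiso : IsIsometry F β := by
    have hd := congrArg (Div F) hβ
    rw [div_comp, div_comp, show Div F a = 1 from hiso, map_one, one_mul, show Div F φ = 1 from hφiso,
      one_pow, map_one, one_mul, show degFr F φ = 1 from hφlin, PNat.one_coe, pow_one] at hd
    exact hd.symm
  have hβbi : IsBaseIso F β := by
    show IsIso (Base F β); rw [hβb]; infer_instance
  haveI : IsIso β := isIso_of_isLBInvertible_of_isPreStep F hF β
    ⟨isCoAngular_endo F hF β, hβiso⟩ ⟨hβlin, hβbi⟩
  -- the witness in `C′`
  have hφw : Base F φ ≫ X.e.hom = i.hom ≫ G.map φ' := by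
    rw [hφb, Category.assoc, Category.assoc, X.e.inv_hom_id, Category.comp_id]
  have hβw : Base F β ≫ i.hom = i.hom ≫ G.map β'.hom := by
    rw [hβb, Category.assoc, Category.assoc, i.inv_hom_id, Category.comp_id]
  let W : FiberProduct F G := ⟨B, B', i⟩
  let ψ : W ⟶ X := ⟨φ, φ', hφw⟩
  let j : W ≅ W := CFP.isoMk (X := W) (Y := W) (asIso β) β' hβw
  refine ⟨W, ψ, j, CFP.hom_ext ?_ ?_⟩
  · show β ≫ φ = φ ≫ a
    exact hβ.symm
  · show β'.hom ≫ φ' = φ' ≫ f'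
    exact hsq'

/-! ### The repaired clause: isometric lifts -/

/-- **Prop. 1.6 (vi) «Aut^sub-ample», REPAIRED (OURS)**: if every sub-automorphism of `A_D` lifts
to an ISOMETRIC LINEAR endomorphism of `A` ("`A` is isometrically `Aut^sub`-ample" — such a lift is
then a sub-automorphism of `A` by Prop. 1.12 (ii), sufficiency), then `X = (A, A′, α)` is
`Aut^sub`-ample in `C′ = C ×_D D′`.  No hypothesis on `D′ → D` is needed for this clause.  The
printed clause asks only for `A` `Aut^sub`-ample, which is not enough (finding F-w5d202-1).
[cite: MochizukiFrdI2008, Prop. 1.6(vi) p.27] -/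
theorem isAutSubAmple_fiberProduct_of_isometricLifts (hF : IsFrobenioid F) (X : FiberProduct F G)
    (h : ∀ f ∈ autSub (baseObj F X.fst), ∃ a : X.fst ⟶ X.fst,
      IsIsometry F a ∧ IsLinear F a ∧ Base F a = f) :
    IsAutSubAmple (fiberProductFunctor F G) X := by
  intro f' hf'
  let f₀ : X.snd ⟶ X.snd := f'
  have hf₀ : IsSubAutomorphism f₀ := hf'
  obtain ⟨a, hiso, hlin, hb⟩ := h _ (FiberProduct.isSubAutomorphism_conj_map X hf₀)
  have hw : Base F a ≫ X.e.hom = X.e.hom ≫ G.map f₀ := by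
    rw [hb, Category.assoc, Category.assoc, X.e.inv_hom_id, Category.comp_id]
  exact ⟨⟨a, f₀, hw⟩, FiberProduct.isSubAutomorphism_of_isIsometry_isLinear hF X hiso hlin hf₀ hw, rfl⟩

/-- The hypothesis of `isAutSubAmple_fiberProduct_of_isometricLifts` is inherited by `X`: if every
sub-automorphism of `A_D` has an isometric linear lift to `A`, then every sub-automorphism of
`A′ = X_{D′}` has an isometric linear lift to `X` (isometries and Frobenius degrees of `C′` are read
off the projection to `C`, Prop. 1.6 (iii)).  So the repaired clause iterates along towers of
categorical fiber products. [cite: MochizukiFrdI2008, Prop. 1.6(vi) p.27] -/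
theorem isometricLifts_fiberProduct_of_fst (X : FiberProduct F G)
    (h : ∀ f ∈ autSub (baseObj F X.fst), ∃ a : X.fst ⟶ X.fst,
      IsIsometry F a ∧ IsLinear F a ∧ Base F a = f) :
    ∀ f' ∈ autSub (baseObj (fiberProductFunctor F G) X), ∃ a' : X ⟶ X,
      IsIsometry (fiberProductFunctor F G) a' ∧ IsLinear (fiberProductFunctor F G) a' ∧
        Base (fiberProductFunctor F G) a' = f' := by
  intro f' hf'
  let f₀ : X.snd ⟶ X.snd := f'
  have hf₀ : IsSubAutomorphism f₀ := hf'
  obtain ⟨a, hiso, hlin, hb⟩ := h _ (FiberProduct.isSubAutomorphism_conj_map X hf₀)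
  have hw : Base F a ≫ X.e.hom = X.e.hom ≫ G.map f₀ := by
    rw [hb, Category.assoc, Category.assoc, X.e.inv_hom_id, Category.comp_id]
  exact ⟨⟨a, f₀, hw⟩, (isIsometry_fiberProduct_iff _).mpr hiso, (isLinear_fiberProduct_iff _).mpr hlin,
    rfl⟩

/-! ### Corollaries: the printed clause under hypotheses making sub-automorphisms isometric -/

/-- **Prop. 1.6 (vi) «Aut^sub-ample» under Prop. 1.12 (ii) at `A`** (OURS): if `A` is
`Aut^sub`-ample and every sub-automorphism of `A` is isometric (the printed necessity half of
Prop. 1.12 (ii) at `A`, `SubAutomorphismIsIsometryStatement F A`; sub-automorphisms are always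
linear), then `X = (A, A′, α)` is `Aut^sub`-ample in `C′`.  This is the exact residual content of
the printed clause: the printed proof of (vi) is correct for every Frobenioid in which Prop. 1.12
(ii) holds. [cite: MochizukiFrdI2008, Prop. 1.6(vi) p.27] -/
theorem isAutSubAmple_fiberProduct_of_fst_of_subAutomorphismIsIsometry (hF : IsFrobenioid F)
    (X : FiberProduct F G) (hii : SubAutomorphismIsIsometryStatement F X.fst)
    (h : IsAutSubAmple F X.fst) : IsAutSubAmple (fiberProductFunctor F G) X :=
  isAutSubAmple_fiberProduct_of_isometricLifts hF X fun f hf => by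
    obtain ⟨a, ha, haf⟩ := h f hf
    exact ⟨a, hii a ha, IsSubAutomorphism.isLinear ha, haf⟩

/-- **Prop. 1.6 (vi) «Aut^sub-ample» under (H) `AutFixesDiv`** (OURS; abc-iut-L1-t1's explicit
hypothesis "automorphisms act trivially on zero divisors", under which Prop. 1.12 (ii) holds as
printed): `A` `Aut^sub`-ample ⇒ `X = (A, A′, α)` `Aut^sub`-ample in `C′`.
[cite: MochizukiFrdI2008, Prop. 1.6(vi) p.27] -/
theorem isAutSubAmple_fiberProduct_of_fst_of_autFixesDiv (hF : IsFrobenioid F) (hH : AutFixesDiv F)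
    (X : FiberProduct F G) (h : IsAutSubAmple F X.fst) : IsAutSubAmple (fiberProductFunctor F G) X :=
  isAutSubAmple_fiberProduct_of_fst_of_subAutomorphismIsIsometry hF X
    (subAutomorphismIsIsometryStatement_of_autFixesDiv hF.isPreFrobenioid hH X.fst) h

/-- **Prop. 1.6 (vi) «Aut^sub-ample» under the non-expanding hypothesis (H) of RULING P12-NE**
(OURS; `IsAutNonExpandingOn Φ`: base automorphisms never strictly enlarge a divisor, under which
Prop. 1.12 (ii) holds as printed, `EndomorphismsNonExpanding.lean`): `A` `Aut^sub`-ample ⇒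
`X = (A, A′, α)` `Aut^sub`-ample in `C′`. [cite: MochizukiFrdI2008, Prop. 1.6(vi) p.27] -/
theorem isAutSubAmple_fiberProduct_of_fst_of_isAutNonExpandingOn (hF : IsFrobenioid F)
    (hH : IsAutNonExpandingOn Φ) (X : FiberProduct F G) (h : IsAutSubAmple F X.fst) :
    IsAutSubAmple (fiberProductFunctor F G) X :=
  isAutSubAmple_fiberProduct_of_fst_of_subAutomorphismIsIsometry hF X
    (subAutomorphismIsIsometryStatement_of_isAutNonExpandingOn hF.isPreFrobenioid hH X.fst) h

/-- **Prop. 1.6 (vi) «Aut^sub-ample» when base automorphisms act on divisors with finite order**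
(OURS; e.g. every base category whose automorphism groups are torsion, such as the connected
objects of a Galois category — the situation of the arithmetic Frobenioids of [FrdI] Ex. 6.3):
`A` `Aut^sub`-ample ⇒ `X = (A, A′, α)` `Aut^sub`-ample in `C′`.
[cite: MochizukiFrdI2008, Prop. 1.6(vi) p.27] -/
theorem isAutSubAmple_fiberProduct_of_fst_of_finite_order (hF : IsFrobenioid F)
    (hfin : ∀ ⦃A₀ : D⦄ (b : A₀ ≅ A₀), ∃ k : ℕ, 0 < k ∧ ∀ x : Φ.obj (op A₀), (pull Φ b.hom)^[k] x = x)
    (X : FiberProduct F G) (h : IsAutSubAmple F X.fst) : IsAutSubAmple (fiberProductFunctor F G) X :=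
  isAutSubAmple_fiberProduct_of_fst_of_isAutNonExpandingOn hF
    (isAutNonExpandingOn_of_isPreFrobenioid_of_finite_order hF.isPreFrobenioid hfin) X h

/-- **Prop. 1.6 (vi) «Aut^sub-ample» at `Aut`-ample `A` over `Aut`-saturated `A_D`** (OURS): then
every sub-automorphism of `A_D` is an automorphism, lifts to an automorphism of `A` — an isometric
linear endomorphism — and `X = (A, A′, α)` is `Aut^sub`-ample in `C′`.
[cite: MochizukiFrdI2008, Prop. 1.6(vi) p.27] -/
theorem isAutSubAmple_fiberProduct_of_isAutAmple_of_isAutSaturatedObj (hF : IsFrobenioid F)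
    (X : FiberProduct F G) (hamp : IsAutAmple F X.fst) (hsat : IsAutSaturatedObj (baseObj F X.fst)) :
    IsAutSubAmple (fiberProductFunctor F G) X :=
  isAutSubAmple_fiberProduct_of_isometricLifts hF X fun f hf => by
    obtain ⟨j, hj⟩ := hamp (@asIso _ _ _ _ f (hsat f hf))
    haveI : IsIso j.hom := inferInstance
    exact ⟨j.hom, isIsometry_of_isIso F hF.isPreFrobenioid j.hom, isLinear_of_isIso F j.hom,
      congrArg Iso.hom hj⟩

end PreFrobenioid

end Literature.AlgebraicGeometry.Frobenioids
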